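import Mathlib
import HarnessLib

/-!
# A set of embeddings of a number field is determined by its product character; type norms of induced types

Two elementary facts about finite sets `Θ` of ring embeddings `M →+* E` of a number field `M` into a field `E`
of characteristic zero, used with CM types (`Θ` a CM type, `x ↦ ∏_{θ ∈ Θ} θ x` its TYPE NORM, Shimura,
*Abelian Varieties with Complex Multiplication and Modular Functions* (1998) §8.3, Prop. 29: `β = ∏ⱼ α^ψⱼ`
[Shimura1998]):

* (A) `finset_eq_of_prod_apply_eq` — MULTIPLICATIVE INDEPENDENCE OF EMBEDDINGS: `Θ` is determined by its product
  character `x ↦ ∏_{θ ∈ Θ} θ x` on `M ∖ {0}`.  Proof: for a primitive element `α` of `M/ℚ` and `t ∈ ℚ`,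
  `∏_{θ ∈ Θ} (t - θ α)` is the product character at `t - α`, so the monic polynomials `∏_{θ ∈ Θ} (X - θ α)` of two
  sets with the same product character agree at infinitely many rationals, hence are equal, hence have the same
  multiset of roots; and `θ ↦ θ α` is injective.  (Folklore; it is the multiplicative shadow of Artin's
  independence of characters and of the Zariski density of `M^×` in `Res_{M/ℚ} 𝔾ₘ`.)
* (B) `prod_norm_eq_prod_filter_comp` — TYPE NORM OF AN INDUCED TYPE: for a tower `M' → M` of number fields, a
  finite set `S` of embeddings `M' →+* E` (`E` algebraically closed) and `x ∈ M`,
  `∏_{σ' ∈ S} σ' (N_{M/M'} x) = ∏_{θ : θ|_{M'} ∈ S} θ x` — the type norm of the type of `M` induced by `S`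
  (Streng, *Complex multiplication of abelian surfaces* (2010) Ch. I Def. 3.2 [Streng2010]) is the type norm of `S`
  composed with the relative norm (Mathlib's `Algebra.norm_eq_prod_embeddings`, fibrewise).
  With (A): `type_eq_induced_of_prod_eq` — a set `Θ` of embeddings of `M` whose product character is
  `x ↦ ∏_{σ' ∈ S} σ' (N_{M/M'} x)` IS the induced type `{θ | θ|_{M'} ∈ S}`.

Everything here is proved (Mathlib only).

## Provenance

Staged by the pub-hodgecm formalisation cell (DAG-node prover #04 lineage) under the LEAN-IN-TREE rule; it
supersedes the standalone package file `HodgeCM/CM/TypeOfDet.lean` §§(A), (B) (where (A)+(B) read a CM type off a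
determinant character).
-/

set_option autoImplicit false

namespace Literature.NumberTheory.ComplexMultiplication

open Polynomial

/-! ### (A) Multiplicative independence of the embeddings of a number field -/

section Independence

variable {M : Type*} [Field M] [NumberField M] {E : Type*} [Field E] [CharZero E]

/-- Two ring embeddings of a number field that agree on a primitive element are equal. [folklore] -/
theorem ringHom_eq_of_apply_gen_eq (θ θ' : M →+* E)
    (h : θ (Field.powerBasisOfFiniteOfSeparable ℚ M).gen = θ' (Field.powerBasisOfFiniteOfSeparable ℚ M).gen) :
    θ = θ' := by
  have key : θ.toRatAlgHom = θ'.toRatAlgHom :=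
    (Field.powerBasisOfFiniteOfSeparable ℚ M).algHom_ext (by simpa [RingHom.toRatAlgHom_apply] using h)
  have := congrArg AlgHom.toRingHom key
  simpa [RingHom.toRatAlgHom_toRingHom] using this

/-- `θ ↦ θ α` is injective for a primitive element `α`. [folklore] -/
theorem apply_gen_injective :
    Function.Injective (fun θ : M →+* E => θ (Field.powerBasisOfFiniteOfSeparable ℚ M).gen) :=
  fun θ θ' h => ringHom_eq_of_apply_gen_eq θ θ' h

/-- **Multiplicative independence of embeddings.**  A finite set `Θ` of ring embeddings `M →+* E` of a number
field `M` into a field `E` of characteristic zero is determined by its product character `x ↦ ∏_{θ ∈ Θ} θ x` on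
`M ∖ {0}`: if `∏_{θ ∈ Θ} θ x = ∏_{θ ∈ Θ'} θ x` for all `x ≠ 0`, then `Θ = Θ'`.  In particular a CM type is
determined by its type norm. [folklore] -/
theorem finset_eq_of_prod_apply_eq {Θ Θ' : Finset (M →+* E)}
    (h : ∀ x : M, x ≠ 0 → ∏ θ ∈ Θ, θ x = ∏ θ ∈ Θ', θ x) : Θ = Θ' := by
  classical
  set α : M := (Field.powerBasisOfFiniteOfSeparable ℚ M).gen with hα
  -- the two polynomials `∏ (X - θ α)`
  set P : E[X] := ((Θ.val.map fun θ : M →+* E => θ α).map fun a => X - C a).prod with hP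
  set P' : E[X] := ((Θ'.val.map fun θ : M →+* E => θ α).map fun a => X - C a).prod with hP'
  have hevalP : ∀ t : E, P.eval t = ∏ θ ∈ Θ, (t - θ α) := by
    intro t
    rw [hP, Multiset.map_map, Polynomial.eval_multiset_prod, Multiset.map_map]
    simp only [Function.comp_def, eval_sub, eval_X, eval_C]
    rfl
  have hevalP' : ∀ t : E, P'.eval t = ∏ θ ∈ Θ', (t - θ α) := by
    intro t
    rw [hP', Multiset.map_map, Polynomial.eval_multiset_prod, Multiset.map_map]
    simp only [Function.comp_def, eval_sub, eval_X, eval_C]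
    rfl
  -- they agree at every rational `t` with `t ≠ α`
  have hagree : ∀ t : ℚ, (t : M) ≠ α → P.eval (t : E) = P'.eval (t : E) := by
    intro t ht
    have hx : (t : M) - α ≠ 0 := sub_ne_zero.mpr ht
    have := h _ hx
    simp only [map_sub, map_ratCast] at this
    rw [hevalP, hevalP']
    exact this
  -- hence they are equal
  have hPP' : P = P' := by
    apply Polynomial.eq_of_infinite_eval_eq
    have hfin : {t : ℚ | (t : M) = α}.Finite :=
      Set.Subsingleton.finite fun t ht t' ht' => Rat.cast_injective (α := M) (ht.trans ht'.symm)
    have hinf : {t : ℚ | (t : M) ≠ α}.Infinite := by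
      have := hfin.infinite_compl
      simpa [Set.compl_setOf] using this
    refine Set.Infinite.mono ?_ (hinf.image (Rat.cast_injective (α := E)).injOn)
    rintro _ ⟨t, ht, rfl⟩
    exact hagree t ht
  -- equal root multisets
  have hroots : Θ.val.map (fun θ : M →+* E => θ α) = Θ'.val.map (fun θ : M →+* E => θ α) := by
    have h1 : P.roots = Θ.val.map (fun θ : M →+* E => θ α) := by
      rw [hP]; exact roots_multiset_prod_X_sub_C _
    have h2 : P'.roots = Θ'.val.map (fun θ : M →+* E => θ α) := by
      rw [hP']; exact roots_multiset_prod_X_sub_C _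
    rw [← h1, ← h2, hPP']
  exact Finset.val_inj.mp (Multiset.map_injective apply_gen_injective hroots)

/-- The same with the (stronger) hypothesis at every `x`. [folklore] -/
theorem finset_eq_of_prod_apply_eq' {Θ Θ' : Finset (M →+* E)}
    (h : ∀ x : M, ∏ θ ∈ Θ, θ x = ∏ θ ∈ Θ', θ x) : Θ = Θ' :=
  finset_eq_of_prod_apply_eq fun x _ => h x

/-- Set form (every set of embeddings of a number field is finite). [folklore] -/
theorem set_eq_of_finprod_apply_eq {Θ Θ' : Set (M →+* E)}
    (h : ∀ x : M, x ≠ 0 → ∏ᶠ θ ∈ Θ, θ x = ∏ᶠ θ ∈ Θ', θ x) : Θ = Θ' := by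
  classical
  have hΘ : Θ.Finite := Set.toFinite Θ
  have hΘ' : Θ'.Finite := Set.toFinite Θ'
  have key : hΘ.toFinset = hΘ'.toFinset := by
    refine finset_eq_of_prod_apply_eq fun x hx => ?_
    rw [← finprod_mem_eq_finite_toFinset_prod _ hΘ, ← finprod_mem_eq_finite_toFinset_prod _ hΘ']
    exact h x hx
  simpa using congrArg (fun s : Finset (M →+* E) => (s : Set (M →+* E))) key

end Independence

/-! ### (B) The type norm of an induced type -/

section TypeNorm

variable {M' M : Type*} [Field M'] [NumberField M'] [Field M] [NumberField M] [Algebra M' M]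
  {E : Type*} [Field E] [CharZero E] [IsAlgClosed E]

/-- `σ' (N_{M/M'} x) = ∏_{θ : θ|_{M'} = σ'} θ x` — Mathlib's `Algebra.norm_eq_prod_embeddings`, re-indexed by the
ring embeddings of `M` restricting to `σ'`. [folklore] -/
theorem apply_norm_eq_prod_filter [DecidableEq (M' →+* E)] (σ' : M' →+* E) (x : M) :
    σ' (Algebra.norm M' x) = ∏ θ ∈ Finset.univ.filter (fun θ : M →+* E => θ.comp (algebraMap M' M) = σ'), θ x := by
  haveI : IsScalarTower ℚ M' M := IsScalarTower.of_algebraMap_eq' (Subsingleton.elim _ _)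
  haveI : FiniteDimensional M' M := Module.Finite.of_restrictScalars_finite ℚ M' M
  letI : Algebra M' E := σ'.toAlgebra
  have h := Algebra.norm_eq_prod_embeddings M' E x
  rw [RingHom.algebraMap_toAlgebra] at h
  rw [h]
  symm
  refine Finset.prod_bij (fun θ hθ => ({ θ with commutes' := fun a => ?_ } : M →ₐ[M'] E)) ?_ ?_ ?_ ?_
  · have := RingHom.congr_fun (Finset.mem_filter.mp hθ).2 a
    simpa [RingHom.algebraMap_toAlgebra] using this
  · intro θ hθ
    exact Finset.mem_univ _
  · intro θ₁ _ θ₂ _ h12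
    exact RingHom.ext fun y => by simpa using AlgHom.congr_fun h12 y
  · intro σ _
    refine ⟨σ.toRingHom, Finset.mem_filter.mpr ⟨Finset.mem_univ _, RingHom.ext fun a => ?_⟩, ?_⟩
    · exact σ.commutes a
    · ext y; rfl
  · intro θ hθ
    rfl

/-- **Type norm of an induced type**: `∏_{σ' ∈ S} σ' (N_{M/M'} x) = ∏_{θ : θ|_{M'} ∈ S} θ x` — the type norm of the
type `{θ | θ|_{M'} ∈ S}` of `M` induced by `S` (Streng Def. 3.2) is `N_S ∘ N_{M/M'}`. [cite: Streng2010, Ch. I Def. 3.2] -/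
theorem prod_norm_eq_prod_filter_comp [DecidableEq (M' →+* E)] (S : Finset (M' →+* E)) (x : M) :
    ∏ σ' ∈ S, σ' (Algebra.norm M' x) =
      ∏ θ ∈ Finset.univ.filter (fun θ : M →+* E => θ.comp (algebraMap M' M) ∈ S), θ x := by
  rw [← Finset.prod_fiberwise_eq_prod_filter Finset.univ S (fun θ : M →+* E => θ.comp (algebraMap M' M))
    (fun θ => θ x)]
  exact Finset.prod_congr rfl fun σ' _ => apply_norm_eq_prod_filter σ' x

/-- **A type with the product character of an induced type is the induced type**: if
`∏_{θ ∈ Θ} θ x = ∏_{σ' ∈ S} σ' (N_{M/M'} x)` for all `x ≠ 0` in `M`, then `Θ = {θ | θ|_{M'} ∈ S}`. [folklore] -/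
theorem type_eq_induced_of_prod_eq [DecidableEq (M' →+* E)] (S : Finset (M' →+* E)) (Θ : Finset (M →+* E))
    (h : ∀ x : M, x ≠ 0 → ∏ θ ∈ Θ, θ x = ∏ σ' ∈ S, σ' (Algebra.norm M' x)) :
    Θ = Finset.univ.filter (fun θ : M →+* E => θ.comp (algebraMap M' M) ∈ S) :=
  finset_eq_of_prod_apply_eq fun x hx => by rw [h x hx, prod_norm_eq_prod_filter_comp]

/-- Set form of `type_eq_induced_of_prod_eq`: `Θ = {θ | θ ∘ algebraMap ∈ S}`. [folklore] -/
theorem set_eq_induced_of_finprod_eq (S : Set (M' →+* E)) (Θ : Set (M →+* E))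
    (h : ∀ x : M, x ≠ 0 → ∏ᶠ θ ∈ Θ, θ x = ∏ᶠ σ' ∈ S, σ' (Algebra.norm M' x)) :
    Θ = {θ : M →+* E | θ.comp (algebraMap M' M) ∈ S} := by
  classical
  have hS : S.Finite := Set.toFinite S
  have hΘ : Θ.Finite := Set.toFinite Θ
  have key : hΘ.toFinset = Finset.univ.filter (fun θ : M →+* E => θ.comp (algebraMap M' M) ∈ hS.toFinset) := by
    refine type_eq_induced_of_prod_eq hS.toFinset hΘ.toFinset fun x hx => ?_
    rw [← finprod_mem_eq_finite_toFinset_prod _ hΘ, ← finprod_mem_eq_finite_toFinset_prod _ hS]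
    exact h x hx
  have := congrArg (fun s : Finset (M →+* E) => (s : Set (M →+* E))) key
  simpa [Set.ext_iff] using this

end TypeNorm

end Literature.NumberTheory.ComplexMultiplication
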